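import Literature.MathematicalPhysics.QuantumFieldTheory.Balaban1983to89.Node00.OpsYIds3152Reduction
import Literature.MathematicalPhysics.QuantumFieldTheory.Balaban1983to89.B9PerturbationMajorantsAtLettersPhys
import Literature.MathematicalPhysics.QuantumFieldTheory.Balaban1983to89.B9Thm313WholeRgdFrom3152
import Literature.MathematicalPhysics.QuantumFieldTheory.Balaban1983to89.B9Thm312WholeIdentitiesSplit

/-!
# BalabanUVNodes ∕ N06 ([B9], `Dag.B9_main`) — (3.124) AND (3.152) AT THE CERTIFICATE'S PINS FROM ONE OPERATOR BINDER `hZ : Q∘D∘Γ∘R = 0`: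
# node00-def-Y's reduction `Node00.ids3152_ids3124_of_hZ_parBY` (p641115; five operator identities ⟸ `hZ` + the (3.138) unit) PUSHED THROUGH THE
# COORDINATE READINGS `RcoK ∕ DvcoKH ∕ DvscoKH ∕ GcoK ∕ QcoKH ∕ QscoKH ∕ GcoS` to the knit's schemas `Ids3124 (𝔬12 x) U ∧ Ids3152 (𝔬12 x) (GcoS … (GpY …)) U`

Track A of `YM-PLAN.md` (cell `pub-ymgap`, HUMAN RULING D-0062), node **N06** = [Balaban1985BackgroundPropagators] Thms 3.1–3.15; seat `pub-ymgap-dag-n06-d`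
(s2, «knit N06 at the ₁₁ record»), gen 12.  A HELPER for the stage-11 certificate editions ≥ 41 (the (T-52) edition: `hIds3124 ∕ h152` ↦ one binder `hZ`).

WHAT.  Editions ≤ 40 display, among rows 20–21's binders, `hIds3124 : … → Ids3124 (𝔬12 x) U` ((3.124) p.420 and its G₁-twins p.425: `QG₁DR = 0`, `RD*G₁Q* = 0`,
`RD*G₁DR = R`) and `h152 : … → Ids3152 (𝔬12 x) (fun U => GcoS … (GpY …) U) U` ((3.152) p.426: `RD*G₁ = RΓD*`, `G₁DR = DΓR`), both at the coordinate model `𝔬12` of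
node00-def-Y's Sect.-D letters.  node00-def-Y g23 (INTENT-52, `Node00/OpsYDeltaPrimeAFactor` p640324 + `Node00/OpsYIds3152Reduction` p641115) proved at the OPERATOR
letters that all five follow from print's single (3.115)-class constraint `hZ : Q∘D∘Γ∘R = 0` (Γ = `GpPhysY (parSymY)`, R = `RY (parSymY) Γ`, Q = `QY (parBY)`) and the
(3.138) unit `IsUnit Δ⁽¹⁾(U)` — ★★★ `Node00.ids3152_ids3124_of_hZ_parBY`.  THIS FILE is the model-level push (def-Y: «yours unless 52c»): ★★ `ids3124_ids3152_of_hZ_pins`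
— at the certificate's pins `hG1co12 hQco12 hQsco12 hDvco12 hDvsco12 hRco12` (G₁ fed `G′_phys`, `covLettersY_v4P_G₁`) the two schemas hold for every SU(N)-valued `U`
with `IsUnit Δ⁽¹⁾(U)` and `hZ`; the scalars `c⁻¹ ∕ c ∕ η²c` of the readings cancel exactly (`GcoS … (GpY) = c • coordOpK (G′_phys)`, §1), the chains are
re-associated by the functor calculus of `Node00.OpsYSectDCoords` (`coordOpK(H)_const_comp…`).  §1 two reading identities; §2 the push.
HONEST FRAMING.  Kernel bookkeeping (finite-dimensional linear algebra over landed letters); `hZ` itself REMAINS a displayed hypothesis of the certificate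
(print's (3.115)-class constraint — NOT a theorem of the typed `Q` at curved `U`, node00-def-Y gap O5; it holds at `U = 1`); nothing of [B9] asserted; COUNT-NEUTRAL;
N06 NOT discharged.  One finite 𝕋⁴ programme at fixed `ε` — NOT continuum, NOT OS, NOT the mass gap ∕ Clay.  0 `def`, 0 `sorry`.
-/

noncomputable section

namespace Summit.QuantumFields.YangMills.BalabanUVNodes.N06Ids3152AtPinsPhys

open Literature.MathematicalPhysics.QuantumFieldTheory.Balaban1983to89
open Literature.MathematicalPhysics.QuantumFieldTheory.Balaban1983to89.Node00
open Literature.MathematicalPhysics.QuantumFieldTheory.Balaban1983to89.Node00.OpsYSectDCoords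
open Literature.MathematicalPhysics.QuantumFieldTheory.Balaban1983to89.B6KLevelCensusIndexV1 (KIdx)
open Literature.MathematicalPhysics.QuantumFieldTheory.Balaban1983to89.B9CoReadingCoords (XBK coordOpK GcoK coordOpK_comp)
open Literature.MathematicalPhysics.QuantumFieldTheory.Balaban1983to89.B9CoReadingCoordsH (XHK coordOpKH coordOpK_comp_coordOpKH)
open Literature.MathematicalPhysics.QuantumFieldTheory.Balaban1983to89.B9CoReadingCoordsS (XSK GcoS)
open Literature.MathematicalPhysics.QuantumFieldTheory.Balaban1983to89.B9CoReadingCoordsTranspose (TrIdx trBasis)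
open Literature.MathematicalPhysics.QuantumFieldTheory.Balaban1983to89.B9Thm39ReadingCoords (cR39)
open Literature.MathematicalPhysics.QuantumFieldTheory.Balaban1983to89.B9Thm312Whole (Ops)
open Literature.MathematicalPhysics.QuantumFieldTheory.Balaban1983to89.B9Thm312WholeIdentitiesSplit (Ids3124)
open Literature.MathematicalPhysics.QuantumFieldTheory.Balaban1983to89.B9Thm313WholeRgdFrom3152 (Ids3152)
open Literature.MathematicalPhysics.QuantumFieldTheory.Balaban1983to89.Node00 (deltaOneY G1Y)
open scoped Matrix.Norms.L2Operator

variable {N : ℕ} {d ℓ : ℕ} {hd : 1 ≤ d + 1} {hL : Odd (ℓ + 1) ∧ 1 < ℓ + 1} {b₀ b₁ : ℝ}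

/-! ## §1 Two reading identities: the print-units G′ in the site model, the zero constant family -/

/-- `restrictScalars` of a real multiple written as a complex scalar. [cite: Balaban1985BackgroundPropagators, (3.25) p.394, dictionary] -/
private theorem rS_real_smul {𝔸 : Type} [NormedRing 𝔸] [NormedAlgebra ℂ 𝔸] {T₁ T₂ : Type} (r : ℝ) (f : (T₁ → 𝔸) →ₗ[ℂ] (T₂ → 𝔸)) :
    ((r : ℂ) • f).restrictScalars ℝ = r • f.restrictScalars ℝ := by
  ext x t
  simp only [LinearMap.restrictScalars_apply, LinearMap.smul_apply, Pi.smul_apply, Complex.coe_smul]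

/-- ★ **the knit's site model of `G′_latt` IS the `c`-scaled coordinate operator of `G′_phys`**: `GcoS … (GpY) U = c • coordOpK (G′_phys(U))` (the `η²` of `GcoS`
is the units factor `G′_phys = η²·G′_latt`). [cite: Balaban1985BackgroundPropagators, (3.25) p.394, (3.42) p.397, (3.119) p.419] -/
theorem gcoS_GpY_eq_coordOpK_GpPhysY (i : KIdx d ℓ hd hL b₀ b₁) (B : B9.Backgrounds) (cfg : B.Cfg → CfgY (Matrix (Fin N) (Fin N) ℂ) i) (U₁ : B.Cfg) :
    GcoS i (trBasis N) B cfg (GpY i (parSymY i)) U₁ =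
      cR39 (trBasis N) • coordOpK (trBasis N) (fun _ : Fin (d + 1) => (GpPhysY i (parSymY i) (cfg U₁)).restrictScalars ℝ) := by
  rw [GcoS, GpPhysY_apply, rS_real_smul, coordOpK_smul, smul_smul, mul_comm]

/-- the mixed model of the zero constant family is zero. [cite: Balaban1985BackgroundPropagators, (3.124) p.420, dictionary] -/
theorem coordOpKH_const_zero {𝔸 : Type} [NormedRing 𝔸] [NormedAlgebra ℂ 𝔸] {κ : Type} [Fintype κ] (b : Module.Basis κ ℝ 𝔸) {S S' D : Type} :
    coordOpKH b (fun _ : D => (0 : (S' → 𝔸) →ₗ[ℝ] (S → 𝔸))) = 0 := by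
  have h := coordOpKH_smul b (0 : ℝ) (fun _ : D => (0 : (S' → 𝔸) →ₗ[ℝ] (S → 𝔸)))
  simp only [zero_smul] at h
  simpa using h

/-! ## §2 The push: `Ids3124 ∧ Ids3152` at the pins from `hZ` and the (3.138) unit -/

/-- ★★ **(3.124) + ITS G₁-TWINS AND (3.152) AT THE CERTIFICATE'S PINS FROM ONE BINDER** (module docstring): for an SU(N)-valued (`G ≤ U(N)`-valued) configuration with
`IsUnit Δ⁽¹⁾(U)` ((3.138)) and print's (3.115)-class constraint `hZ : Q∘D∘Γ∘R = 0`, node00-def-Y's five operator identities pushed through the readings: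
`Ids3124 𝔬 U` (`QG₁DR = 0`, `RD*G₁Q* = 0`, `RD*G₁DR = R`) and `Ids3152 𝔬 (GcoS … (GpY …)) U` (`RD*G₁ = RΓD*`, `G₁DR = DΓR`), all scalings cancelling.
[cite: Balaban1985BackgroundPropagators, (3.115) p.419, (3.124) p.420, p.425 («QG₁DR = QDG′R = 0»), (3.138) p.422, (3.151)–(3.152) p.426, (3.25) p.394] -/
theorem ids3124_ids3152_of_hZ_pins (i : KIdx d ℓ hd hL b₀ b₁) (B : B9.Backgrounds) (cfg : B.Cfg → CfgY (Matrix (Fin N) (Fin N) ℂ) i)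
    (Δ2 : BondOpY (Matrix (Fin N) (Fin N) ℂ) i) {g : B9.Geometry} {Y : Type}
    (𝔬 : Ops g B (XBK (TrIdx N) i) Y (XHK (TrIdx N) i) (XSK (TrIdx N) i)) (U₁ : B.Cfg) (hN : 0 < N)
    {G : Subgroup (Matrix (Fin N) (Fin N) ℂ)ˣ} (hG : G ≤ B7Prop2Explicit.unitaryUnits (Matrix (Fin N) (Fin N) ℂ)) (hU : ∀ μ x, cfg U₁ μ x ∈ G)
    (hcf : i.cf * etaS i = 1)
    (hM1 : IsUnit (deltaOneY i (parSymY i) (parBY i) (GpPhysY i (parSymY i)) Δ2 (cfg U₁)))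
    (hG1 : 𝔬.G1 U₁ = GcoK i (trBasis N) B cfg (G1Y i (parSymY i) (parBY i) (GpPhysY i (parSymY i)) Δ2) U₁)
    (hQ : 𝔬.Q U₁ = QcoKH i (trBasis N) B cfg (parBY i) U₁) (hQs : 𝔬.Qstar U₁ = QscoKH i (trBasis N) B cfg (parBY i) U₁)
    (hDv : 𝔬.Dv U₁ = DvcoKH i (trBasis N) B cfg U₁) (hDvs : 𝔬.Dvstar U₁ = DvscoKH i (trBasis N) B cfg U₁)
    (hR : 𝔬.R U₁ = RcoK i (trBasis N) B cfg (parSymY i) (GpPhysY i (parSymY i)) U₁)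
    (hZ : QY i (parBY i) (cfg U₁) ∘ₗ gradY i (cfg U₁) ∘ₗ GpPhysY i (parSymY i) (cfg U₁) ∘ₗ RY i (parSymY i) (GpPhysY i (parSymY i)) (cfg U₁) = 0) :
    Ids3124 𝔬 U₁ ∧ Ids3152 𝔬 (GcoS i (trBasis N) B cfg (GpY i (parSymY i))) U₁ := by
  have hc : cR39 (trBasis N) ≠ 0 := (cR39_trBasis_pos hN).ne'
  obtain ⟨h1, h2, h3, h4, h5⟩ := ids3152_ids3124_of_hZ_parBY i hG hcf Δ2 hU hM1 hZ
  have e1 := congrArg (LinearMap.restrictScalars ℝ) h1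
  have e2 := congrArg (LinearMap.restrictScalars ℝ) h2
  have e3 := congrArg (LinearMap.restrictScalars ℝ) h3
  have e4 := congrArg (LinearMap.restrictScalars ℝ) h4
  have e5 := congrArg (LinearMap.restrictScalars ℝ) h5
  simp only [LinearMap.restrictScalars_zero] at e3 e4
  refine ⟨⟨?_, ?_, ?_⟩, ⟨?_, ?_⟩⟩
  · -- QG₁DR = 0
    rw [hQ, hG1, hDv, hR, QcoKH, GcoK, DvcoKH, RcoK]
    simp only [LinearMap.comp_smul, LinearMap.smul_comp, smul_smul, inv_mul_cancel₀ hc, one_smul,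
      coordOpKH_const_comp_coordOpK_const, coordOpK_const_comp_coordOpKH_const, coordOpKH_const_comp_coordOpKH_const]
    rw [show (fun _ : Fin (d + 1) => (QY i (parBY i) (cfg U₁)).restrictScalars ℝ ∘ₗ ((G1Y i (parSymY i) (parBY i) (GpPhysY i (parSymY i)) Δ2 (cfg U₁)).restrictScalars ℝ ∘ₗ
        ((gradY i (cfg U₁)).restrictScalars ℝ ∘ₗ (RY i (parSymY i) (GpPhysY i (parSymY i)) (cfg U₁)).restrictScalars ℝ))) = fun _ : Fin (d + 1) =>
        (QY i (parBY i) (cfg U₁) ∘ₗ G1Y i (parSymY i) (parBY i) (GpPhysY i (parSymY i)) Δ2 (cfg U₁) ∘ₗ gradY i (cfg U₁) ∘ₗ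
          RY i (parSymY i) (GpPhysY i (parSymY i)) (cfg U₁)).restrictScalars ℝ from rfl, e3, coordOpKH_const_zero, smul_zero]
  · -- RD*G₁Q* = 0
    rw [hR, hDvs, hG1, hQs, RcoK, DvscoKH, GcoK, QscoKH]
    simp only [LinearMap.comp_smul, LinearMap.smul_comp, smul_smul, inv_mul_cancel₀ hc, one_smul,
      coordOpK_const_comp_coordOpKH_const, coordOpKH_const_comp_coordOpKH_const]
    rw [show (fun _ : Fin (d + 1) => (RY i (parSymY i) (GpPhysY i (parSymY i)) (cfg U₁)).restrictScalars ℝ ∘ₗ ((divY i (cfg U₁)).restrictScalars ℝ ∘ₗ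
        ((G1Y i (parSymY i) (parBY i) (GpPhysY i (parSymY i)) Δ2 (cfg U₁)).restrictScalars ℝ ∘ₗ (QsY i (parBY i) (cfg U₁)).restrictScalars ℝ))) = fun _ : Fin (d + 1) =>
        (RY i (parSymY i) (GpPhysY i (parSymY i)) (cfg U₁) ∘ₗ divY i (cfg U₁) ∘ₗ G1Y i (parSymY i) (parBY i) (GpPhysY i (parSymY i)) Δ2 (cfg U₁) ∘ₗ
          QsY i (parBY i) (cfg U₁)).restrictScalars ℝ from rfl, e4, coordOpKH_const_zero, smul_zero]
  · -- RD*G₁DR = R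
    rw [hR, hDvs, hG1, hDv, RcoK, DvscoKH, GcoK, DvcoKH]
    simp only [LinearMap.comp_smul, LinearMap.smul_comp, smul_smul, inv_mul_cancel₀ hc, one_smul,
      coordOpKH_const_comp_coordOpK_const, coordOpK_const_comp_coordOpKH_const, coordOpKH_const_comp_coordOpKH_const]
    rw [show (fun _ : Fin (d + 1) => (RY i (parSymY i) (GpPhysY i (parSymY i)) (cfg U₁)).restrictScalars ℝ ∘ₗ ((divY i (cfg U₁)).restrictScalars ℝ ∘ₗ
        ((G1Y i (parSymY i) (parBY i) (GpPhysY i (parSymY i)) Δ2 (cfg U₁)).restrictScalars ℝ ∘ₗ ((gradY i (cfg U₁)).restrictScalars ℝ ∘ₗ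
          (RY i (parSymY i) (GpPhysY i (parSymY i)) (cfg U₁)).restrictScalars ℝ)))) = fun _ : Fin (d + 1) =>
        (RY i (parSymY i) (GpPhysY i (parSymY i)) (cfg U₁) ∘ₗ divY i (cfg U₁) ∘ₗ G1Y i (parSymY i) (parBY i) (GpPhysY i (parSymY i)) Δ2 (cfg U₁) ∘ₗ
          gradY i (cfg U₁) ∘ₗ RY i (parSymY i) (GpPhysY i (parSymY i)) (cfg U₁)).restrictScalars ℝ from rfl, e5, coordOpKH_eq_coordOpK]
  · -- RD*G₁ = RΓD*
    rw [hR, hDvs, hG1, gcoS_GpY_eq_coordOpK_GpPhysY, RcoK, DvscoKH, GcoK]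
    simp only [LinearMap.comp_smul, LinearMap.smul_comp, smul_smul, mul_inv_cancel₀ hc, one_smul,
      coordOpKH_const_comp_coordOpK_const, coordOpK_const_comp_coordOpKH_const]
    rw [show (fun _ : Fin (d + 1) => (RY i (parSymY i) (GpPhysY i (parSymY i)) (cfg U₁)).restrictScalars ℝ ∘ₗ ((divY i (cfg U₁)).restrictScalars ℝ ∘ₗ
        (G1Y i (parSymY i) (parBY i) (GpPhysY i (parSymY i)) Δ2 (cfg U₁)).restrictScalars ℝ)) = fun _ : Fin (d + 1) =>
        (RY i (parSymY i) (GpPhysY i (parSymY i)) (cfg U₁) ∘ₗ divY i (cfg U₁) ∘ₗ G1Y i (parSymY i) (parBY i) (GpPhysY i (parSymY i)) Δ2 (cfg U₁)).restrictScalars ℝ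
        from rfl, e1]
    rfl
  · -- G₁DR = DΓR
    rw [hG1, hDv, hR, gcoS_GpY_eq_coordOpK_GpPhysY, GcoK, DvcoKH, RcoK]
    simp only [LinearMap.comp_smul, LinearMap.smul_comp, smul_smul, inv_mul_cancel₀ hc, one_smul,
      coordOpKH_const_comp_coordOpK_const, coordOpK_const_comp_coordOpKH_const, ← coordOpK_const_comp]
    rw [show (fun _ : Fin (d + 1) => (G1Y i (parSymY i) (parBY i) (GpPhysY i (parSymY i)) Δ2 (cfg U₁)).restrictScalars ℝ ∘ₗ ((gradY i (cfg U₁)).restrictScalars ℝ ∘ₗ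
        (RY i (parSymY i) (GpPhysY i (parSymY i)) (cfg U₁)).restrictScalars ℝ)) = fun _ : Fin (d + 1) =>
        (G1Y i (parSymY i) (parBY i) (GpPhysY i (parSymY i)) Δ2 (cfg U₁) ∘ₗ gradY i (cfg U₁) ∘ₗ RY i (parSymY i) (GpPhysY i (parSymY i)) (cfg U₁)).restrictScalars ℝ
        from rfl, e2]
    rfl

end Summit.QuantumFields.YangMills.BalabanUVNodes.N06Ids3152AtPinsPhys

end
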